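import Summits.Schanuel.Schanuel.Theorems.RootDecomp1KHyper31

/-!
# RootDecomp1KHyper — lens 6, generation 15 ADDENDUM «EXP-LATTICE-ANCHORED CELL» (ExpAnchorT.lean v2 88910796…, 2341 l) — continuation (RootDecomp1KHyper32): §5b `pwx` / `ytx` / `yx` (with the tree's `pmP` / `pmM`), `partialSum_ytx`, tails, `yx_partial_approx`, `hyperLatApprox_yx`, `ternarySmallForms_yx`

(lens-6 g15-addendum `ExpAnchorT.lean` v2, sha256 88910796…cc8b, farm rc 0 · 0 sorry · axioms std; port by census-1 gen 14 in eight parts RootDecomp1KHyper28–35, cuts of CENSUS-REQUEST STATUS L1561 re-balanced for the 400-line cap,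
critic PORT GO L1568 (e) / ACK L1571; import `RootDecomp1KHyper26`, the source's verbatim g15 plane-lemma copy dropped (exported by Hyper26 in `…HyperCell`), sub-namespace `…HyperCell.LatCell` kept; statements and proofs verbatim
(55 docstrings added, seven generic one-liners privatised with per-part private copies); `hLW : LWMeasure` (tree-proved named fact) stays a binder; `--supports stmt-Schanuel-33363` (residual of record n = 3 := UnanchoredResidual₃′). Nothing here proves Schanuel; rung 0.)
-/

noncomputable section

open Complex IntermediateField Polynomial

namespace Summit.Schanuel.Schanuel.Theorems.RootDecomp1KHyper

namespace HyperCell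

namespace LatCell

variable {n : ℕ}
open Summit.Schanuel.Schanuel.Theorems.RootDecomp1KGeneric (HasHLPairInSpan Rank3SpanResidual
  mem_adjoin_of_mem_span cexp_mem_adjoin_of_mem_span)

/-- The integer form with coefficients `(−A, −B, E)` on `(w₁, w₂, y)` is `E·y − (A w₁ + B w₂)`. -/
private theorem latTriple_form (w₁ w₂ y : ℂ) (A B : ℤ) (E : ℕ) :
    ∑ i, ((![-A, -B, (E : ℤ)] : Fin 3 → ℤ) i : ℂ) * latTriple w₁ w₂ y i =
      (E : ℂ) * y - ((A : ℂ) * w₁ + (B : ℂ) * w₂) := by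
  rw [Fin.sum_univ_three]
  simp only [latTriple_zero, latTriple_one, latTriple_two, Matrix.cons_val_zero,
    Matrix.cons_val_one, Matrix.head_cons, Matrix.cons_val_two, Matrix.tail_cons]
  push_cast
  ring

/-- The height `Σ i, |h i|` of the coefficient vector `(−A, −B, E)` is `|A| + |B| + E`. -/
private theorem latTriple_hsum (A B : ℤ) (E : ℕ) :
    ∑ i, |(((![-A, -B, (E : ℤ)] : Fin 3 → ℤ) i : ℤ) : ℝ)| = |(A : ℝ)| + |(B : ℝ)| + E := by
  rw [Fin.sum_univ_three]
  simp only [Matrix.cons_val_zero, Matrix.cons_val_one, Matrix.head_cons, Matrix.cons_val_two,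
    Matrix.tail_cons, Int.cast_neg, abs_neg, Int.cast_natCast, Nat.abs_cast]

/-- `q · exp(−X^(m+1)) ≤ exp(−X^m)` for `0 < q ≤ X`, `1 ≤ X`. -/
private theorem mul_exp_neg_pow_succ_le {q X : ℝ} (hq : 0 < q) (hqX : q ≤ X) (hX : 1 ≤ X)
    (m : ℕ) : q * Real.exp (-(X ^ (m + 1))) ≤ Real.exp (-(X ^ m)) := by
  have hlog : Real.log q ≤ X ^ (m + 1) - X ^ m :=
    calc Real.log q ≤ q - 1 := Real.log_le_sub_one_of_pos hq
      _ ≤ X - 1 := by linarith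
      _ ≤ X ^ m * (X - 1) := le_mul_of_one_le_left (by linarith) (one_le_pow₀ hX)
      _ = X ^ (m + 1) - X ^ m := by ring
  rw [← Real.exp_log hq, ← Real.exp_add]
  exact Real.exp_le_exp.mpr (by linarith)

/-! ## §5b  An explicit member: `z_E = (1, e^{−√2}, y_E)`, `y_E = Σ_k w_k 2^{−a_k}`, `w_k ∈ {1, e^{−√2}}`

The construction is carried out for an arbitrary real WEIGHT `ξ ∈ (0, 3/2]` (the g15 member is the
instance `ξ = √2`; the member here is `ξ = e^{−√2}`): `y_ξ = Σ_k w_k 2^{−a_k}` with `w_k = 1` for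
even `k` and `w_k = ξ` for odd `k`, `a_0 = 1`, `a_{k+1} = 2^{(k+1)a_k}` (`hexp`).  The partial sums
`(P_K + M_K ξ)/2^{a_K}` are lattice points of `(ℤ + ℤξ)/2^{a_K}` with `P_K, M_K ≥ 1` (`K ≥ 1`), and
they approximate `y_ξ` to hyper-exponential order: `y_ξ` is `HyperLatApprox 1 ξ`, and the small
forms `2^{a_K} y_ξ − P_K − M_K ξ` are GENUINELY TERNARY (all three coefficients nonzero). -/

/-- The weights `w_k`: `1` for even `k`, `ξ` for odd `k`. -/
def pwx (ξ : ℝ) (k : ℕ) : ℝ := if Even k then 1 else ξ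

/-- `pwx ξ k = 1` for even `k`. -/
theorem pwx_of_even (ξ : ℝ) {k : ℕ} (hk : Even k) : pwx ξ k = 1 := if_pos hk
/-- `pwx ξ k = ξ` for odd `k`. -/
theorem pwx_of_not_even (ξ : ℝ) {k : ℕ} (hk : ¬ Even k) : pwx ξ k = ξ := if_neg hk

/-- `pwx ξ k` is positive when `ξ > 0`. -/
theorem pwx_pos {ξ : ℝ} (hξ : 0 < ξ) (k : ℕ) : 0 < pwx ξ k := by
  unfold pwx; split
  · exact one_pos
  · exact hξ

/-- `pwx ξ k ≤ 3/2` when `ξ ≤ 3/2`. -/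
theorem pwx_le {ξ : ℝ} (hξ : ξ ≤ 3 / 2) (k : ℕ) : pwx ξ k ≤ 3 / 2 := by
  unfold pwx; split
  · norm_num
  · exact hξ

/-- `pwx 1 k = 1`. -/
@[simp] theorem pwx_one (k : ℕ) : pwx 1 k = 1 := by
  unfold pwx; split <;> rfl

/-- The terms `w_k 2^{−a_k}`. -/
def ytx (ξ : ℝ) (k : ℕ) : ℝ := pwx ξ k / (2 : ℝ) ^ hexp k

/-- Every term `ytx ξ k = pwx ξ k / 2^{a_k}` is positive when `ξ > 0`. -/
theorem ytx_pos {ξ : ℝ} (hξ : 0 < ξ) (k : ℕ) : 0 < ytx ξ k := div_pos (pwx_pos hξ k) (by positivity)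

/-- `ytx ξ k ≤ (3/2) / 2^{a_k}` when `ξ ≤ 3/2`. -/
theorem ytx_le {ξ : ℝ} (hξ : ξ ≤ 3 / 2) (k : ℕ) : ytx ξ k ≤ (3 / 2) * (1 / (2 : ℝ) ^ hexp k) := by
  rw [ytx, div_eq_mul_one_div]
  exact mul_le_mul_of_nonneg_right (pwx_le hξ k) (by positivity)

/-- The terms `ytx ξ k` are non-negative when `ξ ≥ 0`. -/
theorem ytx_nonneg_of_le {ξ : ℝ} (hξ : 0 ≤ ξ) (k : ℕ) : 0 ≤ ytx ξ k := by
  unfold ytx pwx; split <;> positivity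

/-- The series `Σ ytx ξ k` is summable for `0 ≤ ξ ≤ 3/2`. -/
theorem summable_ytx {ξ : ℝ} (hξ0 : 0 ≤ ξ) (hξ : ξ ≤ 3 / 2) : Summable (ytx ξ) :=
  Summable.of_nonneg_of_le (ytx_nonneg_of_le hξ0) (ytx_le hξ) (summable_lambdaH.mul_left _)

/-- `y_ξ = Σ_k w_k 2^{−a_k}`. -/
def yx (ξ : ℝ) : ℝ := ∑' k, ytx ξ k

/-- **Partial sums**: `Σ_{k ≤ K} w_k 2^{−a_k} = (P_K + M_K ξ)/2^{a_K}`. -/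
theorem partialSum_ytx (ξ : ℝ) (K : ℕ) :
    ∑ k ∈ Finset.range (K + 1), ytx ξ k = ((pmP K : ℝ) + (pmM K : ℝ) * ξ) / (2 : ℝ) ^ hexp K := by
  induction K with
  | zero => simp [ytx, pwx, pmP, pmM]
  | succ K ih =>
      rw [Finset.sum_range_succ, ih, ytx, two_pow_hexp_succ K]
      have h2 : (0 : ℝ) < 2 ^ hexp K := by positivity
      have h3 : (0 : ℝ) < 2 ^ (hexp (K + 1) - hexp K) := by positivity
      by_cases hK : Even (K + 1)
      · rw [pwx_of_even ξ hK]
        simp only [pmP, pmM, if_pos hK]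
        push_cast
        field_simp
        ring
      · rw [pwx_of_not_even ξ hK]
        simp only [pmP, pmM, if_neg hK]
        push_cast
        field_simp
        ring

/-- The numerators `P_K` are at least `1`. -/
theorem one_le_pmP (K : ℕ) : 1 ≤ pmP K := by
  induction K with
  | zero => simp [pmP]
  | succ K ih =>
      show 1 ≤ pmP K * 2 ^ (hexp (K + 1) - hexp K) + if Even (K + 1) then 1 else 0
      have : 1 ≤ pmP K * 2 ^ (hexp (K + 1) - hexp K) := Nat.le_mul_of_pos_right _ Nat.one_le_two_pow |>.trans' ih
      omega

/-- The numerators `M_K` are at least `1` for `K ≥ 1`. -/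
theorem one_le_pmM {K : ℕ} (hK : 1 ≤ K) : 1 ≤ pmM K := by
  induction K with
  | zero => omega
  | succ K ih =>
      show 1 ≤ pmM K * 2 ^ (hexp (K + 1) - hexp K) + if Even (K + 1) then 0 else 1
      by_cases hK1 : Even (K + 1)
      · rw [if_pos hK1, add_zero]
        have hK0 : 1 ≤ K := by
          rcases Nat.eq_zero_or_pos K with h | h
          · subst h; exact absurd hK1 (by decide)
          · exact h
        exact (ih hK0).trans (Nat.le_mul_of_pos_right _ Nat.one_le_two_pow)
      · rw [if_neg hK1]; omega

/-- Size of the numerators: `P_K + M_K = 2^{a_K} Σ_{k ≤ K} 2^{−a_k} ≤ 2^{a_K} λ_H ≤ 2^{a_K}`. -/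
theorem pmP_add_pmM_le_pow (K : ℕ) : (pmP K : ℝ) + pmM K ≤ 2 ^ hexp K := by
  have h1 : ((pmP K : ℝ) + (pmM K : ℝ) * 1) / (2 : ℝ) ^ hexp K ≤ 1 := by
    rw [← partialSum_ytx 1 K]
    have e : ∀ k, ytx 1 k = 1 / (2 : ℝ) ^ hexp k := fun k => by simp [ytx]
    simp_rw [e]
    calc ∑ k ∈ Finset.range (K + 1), 1 / (2 : ℝ) ^ hexp k ≤ lambdaH :=
          summable_lambdaH.sum_le_tsum (Finset.range (K + 1)) (fun k _ => by positivity)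
      _ ≤ 1 := lambdaH_le_one
  have h2 : (0 : ℝ) < 2 ^ hexp K := by positivity
  rw [div_le_iff₀ h2, mul_one, one_mul] at h1
  exact h1

/-- `y_ξ` is its `K`-th partial sum plus the tail `Σ_{k ≥ K} ytx ξ k`. -/
theorem yx_eq_partialSum_add_tail {ξ : ℝ} (hξ0 : 0 ≤ ξ) (hξ : ξ ≤ 3 / 2) (K : ℕ) :
    yx ξ = ∑ k ∈ Finset.range K, ytx ξ k + ∑' k, ytx ξ (k + K) :=
  ((summable_ytx hξ0 hξ).sum_add_tsum_nat_add K).symm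

/-- The tails of `Σ ytx ξ` are summable. -/
theorem summable_ytx_tail {ξ : ℝ} (hξ0 : 0 ≤ ξ) (hξ : ξ ≤ 3 / 2) (K : ℕ) :
    Summable fun k => ytx ξ (k + K) :=
  (summable_nat_add_iff K).mpr (summable_ytx hξ0 hξ)

/-- Every tail of `Σ ytx ξ` is positive when `ξ > 0`. -/
theorem yx_tail_pos {ξ : ℝ} (hξ0 : 0 < ξ) (hξ : ξ ≤ 3 / 2) (K : ℕ) : 0 < ∑' k, ytx ξ (k + K) :=
  (summable_ytx_tail hξ0.le hξ K).tsum_pos (fun _ => (ytx_pos hξ0 _).le) 0 (ytx_pos hξ0 _)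

/-- Tail bound: `Σ_{k ≥ K} ytx ξ k ≤ (3/2) · (2 / 2^{a_K})`. -/
theorem yx_tail_le {ξ : ℝ} (hξ0 : 0 ≤ ξ) (hξ : ξ ≤ 3 / 2) (K : ℕ) :
    ∑' k, ytx ξ (k + K) ≤ (3 / 2) * (2 * (1 / (2 : ℝ) ^ hexp K)) :=
  calc ∑' k, ytx ξ (k + K) ≤ ∑' k, (3 / 2) * (1 / (2 : ℝ) ^ hexp (k + K)) :=
        Summable.tsum_le_tsum (fun k => ytx_le hξ _) (summable_ytx_tail hξ0 hξ K)
          (((summable_nat_add_iff K).mpr summable_lambdaH).mul_left _)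
    _ = (3 / 2) * ∑' k, 1 / (2 : ℝ) ^ hexp (k + K) := tsum_mul_left
    _ ≤ (3 / 2) * (2 * (1 / (2 : ℝ) ^ hexp K)) :=
        mul_le_mul_of_nonneg_left (lambdaH_tail_le K) (by norm_num)

/-- `e ≤ 3`. -/
private theorem exp_one_le_three' : Real.exp 1 ≤ 3 := by
  have := Real.exp_one_lt_d9; norm_num at this; linarith

/-- `(1/3)^X ≤ exp(−X)`. -/
private theorem third_pow_le_exp_neg' (X : ℕ) : ((1 : ℝ) / 3) ^ X ≤ Real.exp (-(X : ℝ)) := by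
  have h1 : (1 : ℝ) / 3 ≤ Real.exp (-1) := by
    rw [Real.exp_neg, ← one_div]
    exact one_div_le_one_div_of_le (Real.exp_pos 1) exp_one_le_three'
  calc ((1 : ℝ) / 3) ^ X ≤ Real.exp (-1) ^ X := pow_le_pow_left₀ (by norm_num) h1 X
    _ = Real.exp (-(X : ℝ)) := by rw [← Real.exp_nat_mul]; ring_nf

/-- `3 · 16^{−X} < 3^{−X}` for `X ≥ 1`. -/
private theorem three_mul_sixteenth_pow_lt {X : ℕ} (hX : 1 ≤ X) :
    3 * ((1 : ℝ) / 16) ^ X < ((1 : ℝ) / 3) ^ X := by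
  have e : ((1 : ℝ) / 3) ^ X = ((16 : ℝ) / 3) ^ X * ((1 : ℝ) / 16) ^ X := by
    rw [← mul_pow]; norm_num
  rw [e]
  have h : (3 : ℝ) < ((16 : ℝ) / 3) ^ X :=
    calc (3 : ℝ) < 16 / 3 := by norm_num
      _ ≤ ((16 : ℝ) / 3) ^ X := le_self_pow₀ (by norm_num) (by omega)
  exact mul_lt_mul_of_pos_right h (by positivity)

/-- **The certified approximation**: at `K = 3m + 3` the lattice point `(P_K + M_K ξ)/2^{a_K}` of
`(ℤ + ℤ ξ)/2^{a_K}` approximates `y_ξ` within `exp(−X^m)`, `X = 1 + 2^{a_K} + P_K + M_K`, and is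
not equal to it. -/
theorem yx_partial_approx {ξ : ℝ} (hξ0 : 0 < ξ) (hξ : ξ ≤ 3 / 2) (m : ℕ) :
    (yx ξ : ℂ) ≠ ((((pmP (3 * m + 3) : ℤ) : ℂ)) * 1 + (((pmM (3 * m + 3) : ℤ) : ℂ)) * (ξ : ℂ)) /
        (((2 ^ hexp (3 * m + 3) : ℕ) : ℂ)) ∧
      ‖(yx ξ : ℂ) - ((((pmP (3 * m + 3) : ℤ) : ℂ)) * 1 + (((pmM (3 * m + 3) : ℤ) : ℂ)) * (ξ : ℂ)) /
        (((2 ^ hexp (3 * m + 3) : ℕ) : ℂ))‖ <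
        Real.exp (-((1 + ((2 ^ hexp (3 * m + 3) : ℕ) : ℝ) + |((pmP (3 * m + 3) : ℤ) : ℝ)| +
          |((pmM (3 * m + 3) : ℤ) : ℝ)|) ^ m)) := by
  obtain ⟨K, hK⟩ : ∃ K : ℕ, K = 3 * m + 3 := ⟨_, rfl⟩
  rw [← hK]
  have hA1 : 1 ≤ hexp K := one_le_hexp K
  have hβ : (((pmP K : ℤ) : ℝ) + ((pmM K : ℤ) : ℝ) * ξ) / ((2 ^ hexp K : ℕ) : ℝ) =
      ∑ k ∈ Finset.range (K + 1), ytx ξ k := by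
    rw [partialSum_ytx]; push_cast; ring
  have htail : yx ξ - ∑ k ∈ Finset.range (K + 1), ytx ξ k = ∑' k, ytx ξ (k + (K + 1)) := by
    rw [yx_eq_partialSum_add_tail hξ0.le hξ (K + 1)]; ring
  have htpos := yx_tail_pos hξ0 hξ (K + 1)
  have hC : (yx ξ : ℂ) - ((((pmP K : ℤ) : ℂ)) * 1 + (((pmM K : ℤ) : ℂ)) * (ξ : ℂ)) /
      (((2 ^ hexp K : ℕ) : ℂ)) = ((∑' k, ytx ξ (k + (K + 1)) : ℝ) : ℂ) := by
    rw [← htail, ← hβ]; push_cast; ring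
  refine ⟨?_, ?_⟩
  · intro h
    have h2 : ((∑' k, ytx ξ (k + (K + 1)) : ℝ) : ℂ) = 0 := by rw [← hC, h, sub_self]
    exact htpos.ne' (by exact_mod_cast h2)
  · rw [hC, Complex.norm_real, Real.norm_eq_abs, abs_of_pos htpos]
    set Y : ℕ := 2 ^ (m * (hexp K + 2)) with hY
    have hY1 : 1 ≤ Y := Nat.one_le_two_pow
    have hX : (1 + ((2 ^ hexp K : ℕ) : ℝ) + |((pmP K : ℤ) : ℝ)| + |((pmM K : ℤ) : ℝ)|) ^ m ≤ (Y : ℝ) := by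
      have hPM := pmP_add_pmM_le_pow K
      have h2A : (1 : ℝ) ≤ 2 ^ hexp K := one_le_pow₀ (by norm_num)
      have hle : 1 + ((2 ^ hexp K : ℕ) : ℝ) + |((pmP K : ℤ) : ℝ)| + |((pmM K : ℤ) : ℝ)| ≤
          (2 : ℝ) ^ (hexp K + 2) := by
        push_cast
        rw [Nat.abs_cast, Nat.abs_cast, pow_add]
        nlinarith [hPM, h2A]
      calc _ ≤ ((2 : ℝ) ^ (hexp K + 2)) ^ m := pow_le_pow_left₀ (by positivity) hle m
        _ = (Y : ℝ) := by rw [hY]; push_cast; rw [← pow_mul, Nat.mul_comm]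
    have h4Y : 4 * Y ≤ hexp (K + 1) := by rw [hY]; exact four_mul_two_pow_le_hexp_succ m K (by omega)
    have hcmp : 1 / (2 : ℝ) ^ hexp (K + 1) ≤ 1 / (2 : ℝ) ^ (4 * Y) :=
      one_div_le_one_div_of_le (by positivity) (pow_le_pow_right₀ (by norm_num) h4Y)
    have e16 : (1 : ℝ) / (2 : ℝ) ^ (4 * Y) = ((1 : ℝ) / 16) ^ Y := by
      rw [pow_mul, one_div_pow]; norm_num
    calc ∑' k, ytx ξ (k + (K + 1)) ≤ (3 / 2) * (2 * (1 / (2 : ℝ) ^ hexp (K + 1))) :=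
          yx_tail_le hξ0.le hξ (K + 1)
      _ ≤ (3 / 2) * (2 * (1 / (2 : ℝ) ^ (4 * Y))) :=
          mul_le_mul_of_nonneg_left (mul_le_mul_of_nonneg_left hcmp (by norm_num)) (by norm_num)
      _ = 3 * ((1 : ℝ) / 16) ^ Y := by rw [e16]; ring
      _ < ((1 : ℝ) / 3) ^ Y := three_mul_sixteenth_pow_lt hY1
      _ ≤ Real.exp (-(Y : ℝ)) := third_pow_le_exp_neg' Y
      _ ≤ Real.exp (-((1 + ((2 ^ hexp K : ℕ) : ℝ) + |((pmP K : ℤ) : ℝ)| + |((pmM K : ℤ) : ℝ)|) ^ m)) :=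
          Real.exp_le_exp.mpr (neg_le_neg hX)

/-- **`y_ξ` is hyper-approximable from the lattice `ℤ + ℤ ξ`** — explicit, certified witnesses. -/
theorem hyperLatApprox_yx {ξ : ℝ} (hξ0 : 0 < ξ) (hξ : ξ ≤ 3 / 2) :
    HyperLatApprox 1 (ξ : ℂ) (yx ξ : ℂ) := by
  intro m
  obtain ⟨hne, hlt⟩ := yx_partial_approx hξ0 hξ m
  exact ⟨(pmP (3 * m + 3) : ℤ), (pmM (3 * m + 3) : ℤ), 2 ^ hexp (3 * m + 3), by positivity, hne,
    by exact_mod_cast hlt⟩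

/-- **The small forms of `(1, ξ, y_ξ)` are GENUINELY TERNARY**: at every level `m` there is a small
form `h = (−P_K, −M_K, 2^{a_K})` with ALL THREE coefficients nonzero. -/
theorem ternarySmallForms_yx {ξ : ℝ} (hξ0 : 0 < ξ) (hξ : ξ ≤ 3 / 2) (m : ℕ) :
    ∃ h : Fin 3 → ℤ, (∀ i, h i ≠ 0) ∧
      ‖∑ i, (h i : ℂ) * latTriple 1 (ξ : ℂ) (yx ξ : ℂ) i‖ <
        Real.exp (-((1 + ∑ i, |(h i : ℝ)|) ^ m)) := by
  obtain ⟨hne, hlt⟩ := yx_partial_approx hξ0 hξ (m + 1)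
  obtain ⟨K, hK⟩ : ∃ K : ℕ, K = 3 * (m + 1) + 3 := ⟨_, rfl⟩
  rw [← hK] at hne hlt
  have hP := one_le_pmP K
  have hM := one_le_pmM (K := K) (by omega)
  have hE2 : (2 : ℕ) ^ hexp K ≠ 0 := pow_ne_zero _ (by norm_num)
  refine ⟨![-(pmP K : ℤ), -(pmM K : ℤ), ((2 ^ hexp K : ℕ) : ℤ)], ?_, ?_⟩
  · intro i
    match i with
    | 0 => show -(pmP K : ℤ) ≠ 0; omega
    | 1 => show -(pmM K : ℤ) ≠ 0; omega
    | 2 => show ((2 ^ hexp K : ℕ) : ℤ) ≠ 0; exact_mod_cast hE2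
  · rw [latTriple_form, latTriple_hsum]
    have hE0 : (0 : ℝ) < ((2 ^ hexp K : ℕ) : ℝ) := by positivity
    have hEC : ((2 ^ hexp K : ℕ) : ℂ) ≠ 0 := by exact_mod_cast hE2
    set X : ℝ := 1 + ((2 ^ hexp K : ℕ) : ℝ) + |((pmP K : ℤ) : ℝ)| + |((pmM K : ℤ) : ℝ)| with hX
    have hX1 : 1 ≤ X := by
      rw [hX]; linarith only [hE0, abs_nonneg ((pmP K : ℤ) : ℝ), abs_nonneg ((pmM K : ℤ) : ℝ)]
    have hEX : ((2 ^ hexp K : ℕ) : ℝ) ≤ X := by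
      rw [hX]; linarith only [abs_nonneg ((pmP K : ℤ) : ℝ), abs_nonneg ((pmM K : ℤ) : ℝ)]
    have e : (((2 ^ hexp K : ℕ)) : ℂ) * (yx ξ : ℂ) -
        ((((pmP K : ℤ)) : ℂ) * 1 + (((pmM K : ℤ)) : ℂ) * (ξ : ℂ)) =
        (((2 ^ hexp K : ℕ)) : ℂ) * ((yx ξ : ℂ) -
          ((((pmP K : ℤ)) : ℂ) * 1 + (((pmM K : ℤ)) : ℂ) * (ξ : ℂ)) / (((2 ^ hexp K : ℕ)) : ℂ)) := by
      field_simp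
    have eX : 1 + (|((pmP K : ℤ) : ℝ)| + |((pmM K : ℤ) : ℝ)| + ((2 ^ hexp K : ℕ) : ℝ)) = X := by
      rw [hX]; ring
    rw [e, norm_mul, Complex.norm_natCast, eX]
    calc ((2 ^ hexp K : ℕ) : ℝ) * ‖(yx ξ : ℂ) -
          ((((pmP K : ℤ)) : ℂ) * 1 + (((pmM K : ℤ)) : ℂ) * (ξ : ℂ)) / (((2 ^ hexp K : ℕ)) : ℂ)‖
        < ((2 ^ hexp K : ℕ) : ℝ) * Real.exp (-(X ^ (m + 1))) := mul_lt_mul_of_pos_left hlt hE0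
      _ ≤ Real.exp (-(X ^ m)) := mul_exp_neg_pow_succ_le hE0 hEX hX1 m

end LatCell

end HyperCell

end Summit.Schanuel.Schanuel.Theorems.RootDecomp1KHyper
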